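import Summits.QuantumFields.BalabanUV.Beta.D1BFx.GluonNeedleRowsT12
import Summits.QuantumFields.BalabanUV.Beta.D1BFx.NeedleNdlProjRow
import Summits.QuantumFields.BalabanUV.Beta.D1BFx.NeedleProjNdlRow
import Summits.QuantumFields.BalabanUV.Beta.D1BFx.NeedleNdlNdlRow
import Summits.QuantumFields.BalabanUV.Beta.D1BFx.NeedleDipDipRow
import Summits.QuantumFields.BalabanUV.Beta.D1BFx.NeedleDipProjRow
import Summits.QuantumFields.BalabanUV.Beta.D1BFx.NeedleDipWardLetter
import Summits.QuantumFields.BalabanUV.Beta.D1BFx.NeedleDipNdlRow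

/-!
# `BalabanUV.Beta.D1BFx.GluonNeedleRowT3` — road «BF-x» for binder row D1, slot (K), END row `hGrp gN`, «GN-WIRE» PART 2: THE GLUON NEEDLE TABLE ROW T₃
# (`SbRc ⊗ SbRc`) OF `NeedleRowGlue.abs_gN_row_le_of_tables` AT THE RAY OF RECORD — `h₃` from the SEVEN LANDED cells (PP owner; NP, PN leaf-01; NN gan24-leaf-05-g42;
# KK leaf-04-g9; KP, PK leaf-04-g10) and TWO displayed cell hypotheses (NK, KN — leaf-01, in flight) plus KK's displayed pairing letter `h𝔅₂₂` (leaf-04-g10, in flight),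
# modulo [B5, Prop. 1.2] ∧ [B5, (1.126)–(1.127)] BY NAME, the END's pins `hlam`, `cE = n⁴`, `cR = −cE`, the ray `cK n = cgh n·n²`, `cQ n = cgh n·a`, `|cgh n| ≤ cgh₀` (P13)

HONEST DEPENDENCY (cell records, verbatim): «continuum YM on T⁴ ⇐ BetaPertH ∧ nine spine estimates (0/9 proved); BetaPertH ⇐ (D1) ∧ (D4) ∧
CAP+tail; G-an2-4 gates asym, D1 and NE2/3/4.»  HONEST FRAMING (cell contract, verbatim): «discharging `BetaPertH` makes Bałaban's UV stability
UNCONDITIONAL — a real constructive-QFT result; it is NOT the continuum limit and NOT the Clay problem.»  THIS MODULE DISCHARGES NOTHING of the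
wall: [folklore] wiring BY NAME — `GluonNeedleGlue.h₃_of_cells` (owner) fed with `NeedleProjProjRow.exists_projProj_row_le` (owner), `NeedleNdlProjRow.exists_ndlProj_row_le` ∕
`NeedleProjNdlRow.exists_projNdl_row_le` (leaf-01; `cQ₀ := cgh₀·a`), `NeedleNdlNdlRow.exists_ndlNdl_row_le` (gan24-leaf-05-g42), `NeedleDipDipRow.exists_dipDip_row_le` (leaf-04-g9; at the
CONSTANT auxiliary weight `cgh₀·n²`, its equality pin `cK n = cgh₀·n²` met by `rfl`, then `|cK n|² ≤ (cgh₀n²)²`), `NeedleDipProjRow.exists_dipProj_row_le` ∕ `exists_projDip_row_le` (leaf-04-g10;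
`|cK n| ≤ cgh₀·n²`).  No `def`, no `def … : Prop`, nothing cited, 0 sorry; the printed statements, the two missing cells and `h𝔅₂₂` are HYPOTHESES, displayed.  P13 is
LOAD-BEARING: the constant depends on `cgh₀`.  Root-level binders hW ∕ hR-sockets ∕ hSX-socket ∕ D1Tel ∕ D1Rep — 0 discharged; (K) NOT closed; NOT D1, NOT `BetaPertH`,
NOT continuum, NOT Clay.

ABSOLUTE RULE (cell charter, verbatim): «No internally-minted statement may enter as a cited fact. Every hypothesis is either kernel-proved in
this package or a verbatim quotation of a PUBLISHED theorem with page reference. The manuscript(s) under audit are NOT citable for their own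
disputed steps — they are the thing under adjudication; programme-internal (2001/route/tribunal) claims are never citable.»

CONTENT.
* §1 [folklore] `abs_weight_le_aux`, `abs_weight2_cell_le` (the true weights against the auxiliary constant weight).
* §2 [folklore] **`h₃_of_prop12`** — `∃ C₃ ≥ 0, ∀ n ≥ 2, |ωgl n·Σ_b n⁻⁴·(n⁻⁸·fullSum (w ↦ w_μw_ν·biBubbleTable Ga Ga SbRc SbRc μ ν (b+w) b))| ≤ C₃`, modulo the displayed
  `hNK`, `hKN` (cells, auxiliary-weight form) and `h𝔅₂₂` (KK's pairing letter).
* §4 (v1.2) [folklore] **`h₃_of_prop12''`** — NO cell hypothesis (NK∕KN = leaf-01's `NeedleNdlDipRow`∕`NeedleDipNdlRow`, p281106∕p282148).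
* §3 (v1.1) [folklore] **`h₃_of_prop12'`** — the same modulo `hNK`, `hKN` ONLY (`h𝔅₂₂` = leaf-04-g10's `NeedleDipWardLetter.exists_wardPairing_le`, p275771).
NOT HERE (honest): the two cells and the letter themselves; T₈; the `hGrp` assembly.
Unit `b2b-balaban-beta-d1-p2` (gen 11), road «BF-x» OWNER; `LEAVES-BFx.md` row (N) «GN-WIRE» PART 2.
-/

noncomputable section

namespace Summit.QuantumFields.BalabanUV.Beta.D1BFx.GluonNeedleRowT3

open Finset
open scoped BigOperators
open Literature.MathematicalPhysics.QuantumFieldTheory.Balaban1983to89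
open Literature.MathematicalPhysics.QuantumFieldTheory.Balaban1983to89.Beta
open ExpKernelCalculus (Site MKer)
open DyadicShell (Pt toReal toReal_apply)
open WindowIdentification (fullSum)
open DressedMomentNormalisation (resSite)
open AffineAveraging (unitVec)
open VectorTailsLoc (fam kfam)
open PoissonInterior (nrm supNorm)
open Summit.QuantumFields.BalabanUV.Beta.TameKernelCalculus (Spr)
open Summit.QuantumFields.BalabanUV.Beta.D1BFx.ReducedKernel (StencilR)
open Summit.QuantumFields.BalabanUV.Beta.D1BFx.FineHessianSectors (biBubbleTable)
open Summit.QuantumFields.BalabanUV.Beta.D1BFx.RProjector (Pgt)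
open Summit.QuantumFields.BalabanUV.Beta.D1BFx.GhostLeg (Ggh)
open Summit.QuantumFields.BalabanUV.Beta.D1BFx.RProjectorJet (RG)
open Summit.QuantumFields.BalabanUV.Beta.D1BFx.GluonLeg (Ga)
open Summit.QuantumFields.BalabanUV.Beta.D1BFx.GluonLegTails (spr_Ga_of_prop12)
open Summit.QuantumFields.BalabanUV.Beta.D1BFx.FrozenLegTails (nOf MOf hn1)
open Summit.QuantumFields.BalabanUV.Beta.D1BFx.SectorRecut (SbRc)
open Summit.QuantumFields.BalabanUV.Beta.D1BFx.GluonNeedleSplit (projPiece dipPiece ndlPiece)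
open Summit.QuantumFields.BalabanUV.Beta.D1BFx.GluonNeedleGlue (cellSum cellSum_def h₃_of_cells)
open Summit.QuantumFields.BalabanUV.Beta.D1BFx.RankOneBubble (applyK pairing)
open Summit.QuantumFields.BalabanUV.Beta.D1BFx.RankOneBubbleJets (grad)
open Summit.QuantumFields.BalabanUV.Beta.D1BFx.GluonNeedleRowsT12 (zero_le_cgh₀ abs_cQ_le abs_weight_cell_le)
open Summit.QuantumFields.BalabanUV.Beta.D1BFx.NeedleProjProjRow (exists_projProj_row_le)
open Summit.QuantumFields.BalabanUV.Beta.D1BFx.NeedleNdlProjRow (exists_ndlProj_row_le)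
open Summit.QuantumFields.BalabanUV.Beta.D1BFx.NeedleProjNdlRow (exists_projNdl_row_le)
open Summit.QuantumFields.BalabanUV.Beta.D1BFx.NeedleNdlNdlRow (exists_ndlNdl_row_le)
open Summit.QuantumFields.BalabanUV.Beta.D1BFx.NeedleDipDipRow (exists_dipDip_row_le)
open Summit.QuantumFields.BalabanUV.Beta.D1BFx.NeedleDipProjRow (exists_dipProj_row_le exists_projDip_row_le)

variable {a N cgh₀ : ℝ} {cE cR cK cQ ωgl cgh : ℕ → ℝ}

/-! ## §1 The true weights against the auxiliary constant weight -/

/-- [folklore] `|cK n| ≤ cgh₀·n²` at the ray. -/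
theorem abs_weight_le_aux (hcgh : ∀ n : ℕ, |cgh n| ≤ cgh₀) (hK : ∀ n : ℕ, cK n = cgh n * (n : ℝ) ^ 2) (n : ℕ) : |cK n| ≤ cgh₀ * (n : ℝ) ^ 2 := by
  rw [hK, abs_mul, abs_of_nonneg (by positivity : (0 : ℝ) ≤ (n : ℝ) ^ 2)]
  exact mul_le_mul_of_nonneg_right (hcgh n) (by positivity)

/-- [folklore] **THE SQUARED TRUE WEIGHT AGAINST THE SQUARED AUXILIARY WEIGHT**: `|cK n·cK n·S| ≤ |cgh₀n²·(cgh₀n²)·S|`. -/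
theorem abs_weight2_cell_le (hcgh : ∀ n : ℕ, |cgh n| ≤ cgh₀) (hK : ∀ n : ℕ, cK n = cgh n * (n : ℝ) ^ 2) (n : ℕ) (S : ℝ) :
    |cK n * cK n * S| ≤ |cgh₀ * (n : ℝ) ^ 2 * (cgh₀ * (n : ℝ) ^ 2) * S| := by
  have h0 := zero_le_cgh₀ hcgh
  have h1 := abs_weight_le_aux hcgh hK n
  have h2 : |cK n * cK n| ≤ cgh₀ * (n : ℝ) ^ 2 * (cgh₀ * (n : ℝ) ^ 2) := by
    rw [abs_mul]; exact mul_le_mul h1 h1 (abs_nonneg _) (by positivity)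
  rw [abs_mul (cK n * cK n), abs_mul (cgh₀ * (n : ℝ) ^ 2 * (cgh₀ * (n : ℝ) ^ 2)),
    abs_of_nonneg (by positivity : (0 : ℝ) ≤ cgh₀ * (n : ℝ) ^ 2 * (cgh₀ * (n : ℝ) ^ 2))]
  exact mul_le_mul_of_nonneg_right h2 (abs_nonneg _)

/-! ## §2 The row T₃, modulo NK, KN and `h𝔅₂₂` -/

/-- [folklore] **«GN-WIRE ∕ T₃»: THE GLUON NEEDLE TABLE ROW `h₃` AT THE RAY OF RECORD**, modulo [B5, Prop. 1.2] ∧ [B5, (1.126)–(1.127)] BY NAME, the END's pins `hlam`,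
`cE = n⁴`, `cR = −cE`, the ray `cK n = cgh n·n²`, `cQ n = cgh n·a`, the displayed scalar letter `|cgh n| ≤ cgh₀` (P13), and THREE displayed hypotheses: the cells
`ndl ⊗ dip` (`hNK`) and `dip ⊗ ndl` (`hKN`) at the auxiliary constant weight (claimables «GN-33∕NK∕KN», leaf-01) and KK's pairing letter `h𝔅₂₂` (type `(δρ,δρ′)`,
leaf-04-g10): `∃ C₃ ≥ 0, ∀ n ≥ 2, |ωgl n·Σ_{b ∈ image resSite} n⁻⁴·(n⁻⁸·fullSum (w ↦ w_μw_ν·biBubbleTable Ga Ga SbRc SbRc μ ν (b+w) b))| ≤ C₃`. -/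
theorem h₃_of_prop12 (ha : 0 < a) (h12 : B5.Prop12Printed (fam nOf hn1 MOf a ha)) (h126 : B5.Kernel126_127Printed (kfam nOf MOf))
    (hlam : ∀ n : ℕ, 2 ≤ n → ωgl n * cE n ^ 2 = 2 * N ^ 2 * (n : ℝ) ^ 8) (hcE : ∀ n : ℕ, 2 ≤ n → cE n = (n : ℝ) ^ 4)
    (hR : ∀ n : ℕ, 2 ≤ n → cR n = -cE n) (hcgh : ∀ n : ℕ, |cgh n| ≤ cgh₀) (hK : ∀ n : ℕ, cK n = cgh n * (n : ℝ) ^ 2)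
    (hQ : ∀ n : ℕ, cQ n = cgh n * a) (μ ν : Fin 4)
    (hNK : ∃ C : ℝ, 0 ≤ C ∧ ∀ (n : ℕ) [NeZero n], |cgh₀ * (n : ℝ) ^ 2 * cellSum n a (ndlPiece n a (cQ n)) (dipPiece n a) μ ν| ≤ C)
    (hKN : ∃ C : ℝ, 0 ≤ C ∧ ∀ (n : ℕ) [NeZero n], |cgh₀ * (n : ℝ) ^ 2 * cellSum n a (dipPiece n a) (ndlPiece n a (cQ n)) μ ν| ≤ C)
    {K𝔅 : ℝ} (hK𝔅 : 0 ≤ K𝔅)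
    (h𝔅₂₂ : ∀ (n : ℕ) [NeZero n] (u v : Site 4) (κ κ' : Fin 4),
      |pairing (grad (fun x => RG (Ggh n a) (Pgt n a) x (u + unitVec κ) () () - RG (Ggh n a) (Pgt n a) x u () ()))
        (applyK (Ga n a) (grad (fun x => RG (Ggh n a) (Pgt n a) x (v + unitVec κ') () () - RG (Ggh n a) (Pgt n a) x v () ())))|
        ≤ K𝔅 / (n : ℝ) ^ 4 / nrm (u - v) ^ 2 + K𝔅 / (n : ℝ) ^ 6) :
    ∃ C₃ : ℝ, 0 ≤ C₃ ∧ ∀ n : ℕ, 2 ≤ n → ∀ [NeZero n], |ωgl n * ∑ b ∈ (univ : Finset (Fin 4 → Fin n)).image resSite, ((n : ℝ) ^ 4)⁻¹ * (((n : ℝ) ^ 8)⁻¹ *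
      fullSum (fun w : Pt => toReal w μ * toReal w ν *
        biBubbleTable (Ga n a) (Ga n a) (SbRc n a (cE n) (cR n) (cK n) (cQ n)) (SbRc n a (cE n) (cR n) (cK n) (cQ n)) μ ν (b + w) b))| ≤ C₃ := by
  have hGa : ∀ n : ℕ, 2 ≤ n → ∀ [NeZero n], Spr (Ga n a) := fun n _ _ => spr_Ga_of_prop12 (a := a) (ha := ha) h12 h126 n
  have hcQ := abs_cQ_le ha hcgh hQ
  have hcK := abs_weight_le_aux hcgh hK
  obtain ⟨Cdd, hCdd, hdd⟩ := exists_dipDip_row_le ha h12 h126 (cK := fun n => cgh₀ * (n : ℝ) ^ 2) (cgh := cgh₀) (fun _ => rfl) hK𝔅 h𝔅₂₂ μ ν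
  obtain ⟨Cdn, hCdn, hdn⟩ := hKN
  obtain ⟨Cdp, hCdp, hdp⟩ := exists_dipProj_row_le ha h12 h126 (cK := cK) (cgh := cgh₀) hcK μ ν
  obtain ⟨Cnd, hCnd, hnd⟩ := hNK
  obtain ⟨Cnn, hCnn, hnn⟩ := exists_ndlNdl_row_le (a := a) ha h12 h126 (cQ := cQ) (cQ₀ := cgh₀ * a) hcQ μ ν
  obtain ⟨Cnp, hCnp, hnp⟩ := exists_ndlProj_row_le (a := a) ha h12 h126 (cQ := cQ) (cQ₀ := cgh₀ * a) hcQ μ ν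
  obtain ⟨Cpd, hCpd, hpd⟩ := exists_projDip_row_le ha h12 h126 (cK := cK) (cgh := cgh₀) hcK μ ν
  obtain ⟨Cpn, hCpn, hpn⟩ := exists_projNdl_row_le (a := a) ha h12 h126 (cQ := cQ) (cQ₀ := cgh₀ * a) hcQ μ ν
  obtain ⟨Cpp, hCpp, hpp⟩ := exists_projProj_row_le (a := a) ha h12 h126 μ ν
  refine ⟨2 * N ^ 2 * (Cdd + Cdn + Cdp + Cnd + Cnn + Cnp + Cpd + Cpn + Cpp), by positivity, ?_⟩
  refine h₃_of_cells (cK := cK) (cQ := cQ) ha hGa hlam hcE hR μ ν (fun n hn _ => ?_) (fun n _ _ => ?_) (fun n hn _ => hdp n hn) (fun n _ _ => ?_)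
    (fun n _ _ => hnn n) (fun n _ _ => hnp n) (fun n hn _ => hpd n hn) (fun n _ _ => hpn n) (fun n _ _ => ?_)
  · exact (abs_weight2_cell_le hcgh hK n _).trans (hdd n hn)
  · exact (abs_weight_cell_le hcgh hK n _).trans (hdn n)
  · exact (abs_weight_cell_le hcgh hK n _).trans (hnd n)
  · rw [cellSum_def]; exact hpp n

/-! ## §3 (v1.1, APPENDED 2026-08-21 after leaf-04-g10's «h𝔅₂₂» `PairingWardSplit` p274949 ∕ `NeedleDipWardLetter` p275771 landed) The row T₃ modulo the two cells NK, KN only -/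

open Summit.QuantumFields.BalabanUV.Beta.D1BFx.NeedleDipWardLetter (exists_wardPairing_le) in
/-- [folklore] **«GN-WIRE ∕ T₃» WITH KK UNCONDITIONAL: THE GLUON NEEDLE TABLE ROW `h₃` AT THE RAY OF RECORD MODULO THE TWO CELLS NK, KN ONLY** —
`h₃_of_prop12` with its displayed pairing letter `h𝔅₂₂` discharged by leaf-04-g10's `NeedleDipWardLetter.exists_wardPairing_le` (the `(δρ,δρ′)` type by the free
leg's Ward locality + the flat second difference of `Ga − δ·G₀`; needs `0 < a` only).  Displayed: h12∕h126, the pins, the ray with `|cgh n| ≤ cgh₀` (P13), `hNK`, `hKN`. -/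
theorem h₃_of_prop12' (ha : 0 < a) (h12 : B5.Prop12Printed (fam nOf hn1 MOf a ha)) (h126 : B5.Kernel126_127Printed (kfam nOf MOf))
    (hlam : ∀ n : ℕ, 2 ≤ n → ωgl n * cE n ^ 2 = 2 * N ^ 2 * (n : ℝ) ^ 8) (hcE : ∀ n : ℕ, 2 ≤ n → cE n = (n : ℝ) ^ 4)
    (hR : ∀ n : ℕ, 2 ≤ n → cR n = -cE n) (hcgh : ∀ n : ℕ, |cgh n| ≤ cgh₀) (hK : ∀ n : ℕ, cK n = cgh n * (n : ℝ) ^ 2)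
    (hQ : ∀ n : ℕ, cQ n = cgh n * a) (μ ν : Fin 4)
    (hNK : ∃ C : ℝ, 0 ≤ C ∧ ∀ (n : ℕ) [NeZero n], |cgh₀ * (n : ℝ) ^ 2 * cellSum n a (ndlPiece n a (cQ n)) (dipPiece n a) μ ν| ≤ C)
    (hKN : ∃ C : ℝ, 0 ≤ C ∧ ∀ (n : ℕ) [NeZero n], |cgh₀ * (n : ℝ) ^ 2 * cellSum n a (dipPiece n a) (ndlPiece n a (cQ n)) μ ν| ≤ C) :
    ∃ C₃ : ℝ, 0 ≤ C₃ ∧ ∀ n : ℕ, 2 ≤ n → ∀ [NeZero n], |ωgl n * ∑ b ∈ (univ : Finset (Fin 4 → Fin n)).image resSite, ((n : ℝ) ^ 4)⁻¹ * (((n : ℝ) ^ 8)⁻¹ *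
      fullSum (fun w : Pt => toReal w μ * toReal w ν *
        biBubbleTable (Ga n a) (Ga n a) (SbRc n a (cE n) (cR n) (cK n) (cQ n)) (SbRc n a (cE n) (cR n) (cK n) (cQ n)) μ ν (b + w) b))| ≤ C₃ := by
  obtain ⟨K𝔅, hK𝔅, h𝔅⟩ := exists_wardPairing_le (a := a) ha
  exact h₃_of_prop12 ha h12 h126 hlam hcE hR hcgh hK hQ μ ν hNK hKN hK𝔅 (fun n _ u v κ κ' => h𝔅 n u v κ κ')

/-! ## §4 (v1.2, APPENDED 2026-08-21 after leaf-01's «NK∕KN» `NeedleNdlDipRow` p281106 ∕ `NeedleDipNdlRow` p282148 landed) The row T₃ with NO cell hypothesis -/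

open Summit.QuantumFields.BalabanUV.Beta.D1BFx.NeedleNdlDipRow (exists_ndlDip_row_le) in
open Summit.QuantumFields.BalabanUV.Beta.D1BFx.NeedleDipNdlRow (exists_dipNdl_row_le) in
/-- [folklore] **«GN-WIRE ∕ T₃» CLOSED AT THE RAY: THE GLUON NEEDLE TABLE ROW `h₃` WITH NO CELL HYPOTHESIS** — `h₃_of_prop12'` with its two displayed cells discharged
by leaf-01's `NeedleNdlDipRow.exists_ndlDip_row_le` (NK) and `NeedleDipNdlRow.exists_dipNdl_row_le` (KN) at the auxiliary constant weight `cgh₀·n²` (`|cgh₀·n²| ≤ cgh₀·n²`)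
and `cQ₀ := cgh₀·a`.  Displayed: h12∕h126, `hlam`, `cE = n⁴`, `cR = −cE`, the ray `hK`∕`hQ` with `|cgh n| ≤ cgh₀` (P13).  ALL NINE CELLS of `h₃_of_cells` are tree theorems. -/
theorem h₃_of_prop12'' (ha : 0 < a) (h12 : B5.Prop12Printed (fam nOf hn1 MOf a ha)) (h126 : B5.Kernel126_127Printed (kfam nOf MOf))
    (hlam : ∀ n : ℕ, 2 ≤ n → ωgl n * cE n ^ 2 = 2 * N ^ 2 * (n : ℝ) ^ 8) (hcE : ∀ n : ℕ, 2 ≤ n → cE n = (n : ℝ) ^ 4)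
    (hR : ∀ n : ℕ, 2 ≤ n → cR n = -cE n) (hcgh : ∀ n : ℕ, |cgh n| ≤ cgh₀) (hK : ∀ n : ℕ, cK n = cgh n * (n : ℝ) ^ 2)
    (hQ : ∀ n : ℕ, cQ n = cgh n * a) (μ ν : Fin 4) :
    ∃ C₃ : ℝ, 0 ≤ C₃ ∧ ∀ n : ℕ, 2 ≤ n → ∀ [NeZero n], |ωgl n * ∑ b ∈ (univ : Finset (Fin 4 → Fin n)).image resSite, ((n : ℝ) ^ 4)⁻¹ * (((n : ℝ) ^ 8)⁻¹ *
      fullSum (fun w : Pt => toReal w μ * toReal w ν *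
        biBubbleTable (Ga n a) (Ga n a) (SbRc n a (cE n) (cR n) (cK n) (cQ n)) (SbRc n a (cE n) (cR n) (cK n) (cQ n)) μ ν (b + w) b))| ≤ C₃ := by
  have h0 := zero_le_cgh₀ hcgh
  have hcQ := abs_cQ_le ha hcgh hQ
  have haux : ∀ n : ℕ, |cgh₀ * (n : ℝ) ^ 2| ≤ cgh₀ * (n : ℝ) ^ 2 := fun n => (abs_of_nonneg (by positivity)).le
  exact h₃_of_prop12' ha h12 h126 hlam hcE hR hcgh hK hQ μ ν
    (exists_ndlDip_row_le (a := a) ha h12 h126 (cK := fun n => cgh₀ * (n : ℝ) ^ 2) (cgh := cgh₀) haux (cQ := cQ) (cQ₀ := cgh₀ * a) hcQ μ ν)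
    (exists_dipNdl_row_le (a := a) ha h12 h126 (cK := fun n => cgh₀ * (n : ℝ) ^ 2) (cgh := cgh₀) haux (cQ := cQ) (cQ₀ := cgh₀ * a) hcQ μ ν)

end Summit.QuantumFields.BalabanUV.Beta.D1BFx.GluonNeedleRowT3

end
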